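import Summits.HodgeConjecture.CorCM.HypLiu418.A3Liu418GSOmegaHomFactorisation
import Literature.NumberTheory.GelbartRogawski1991.UnitaryDualPairFaceSplitCoinvariants
import Literature.NumberTheory.GelbartRogawski1991.UnitaryDualPairSplitCoinvTransport
import Literature.NumberTheory.Automorphic.Liu2021.Def411WeilCarriersAtLineCoinv
import HarnessLib.Audit.LibrarySuggestionsDenyListCorCM
import HarnessLib

/-!
# GS-6 glue, node G2c PLUGGED: the per-label factorisation at the ADAPTED SPLIT FACE, every junction discharged

Cell hodgecm-mathlib (D-0151), crux `HLiu418` (stmt-HodgeConjecture-24832), line `a3_liu418`, the (β) hoist of [Liu2021, Thm. D.6 (1)]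
(SPEC `A-plan/GS6-HOIST-SPEC.md` §9; placement row S-3b).  Namespace `Summit.HodgeConjecture.CorCM.Lines.A3Liu418`; sequel of
`A3Liu418GSOmegaHomFactorisation` (`exists_factor_slice_mem_omegaHom_GS`, `chiOfWeight`, `psiTilde`, the weight projections) over the
generic Literature leaves `GelbartRogawski1991.UnitaryDualPairFaceSplitCoinvariants` (`faceSplitCoinvEquiv`, [Liu2021] proof of Thm. 4.15:
`R_B(u ⊕ 1) ≅ ω⋆ ⊗ ω⊥` up to the see-saw character), `GelbartRogawski1991.UnitaryDualPairSplitCoinvTransport` (equivariance of split-and-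
transport for a face action) and `Liu2021.Def411WeilCarriersAtLineCoinv` (`coinvLineCenterEquiv`: the at-line carrier as central-character
coinvariants).  KERNEL ONLY: data definitions with bodies (`plugRho₁`, `plugRho₂`, `plugChi`, `plugRhoV`, `plugRho`, `plugPhi`, `plugE`,
`plugRho'` — the G2c data at the adapted face, named to keep statements short, each with its `_def` ∕ `_apply` rfl-lemma) and theorems; no `def … : Prop`, no named fact, no `sorry`.
HC_CM is proved only modulo the 7 printed citations until rung 0 closes; this file discharges none of them.  Edition 2 (watcher
trigger): module docstring only, declarations byte-identical to edition 1.
Edition 3 (post-restart watcher probe, director ruling s161): again module docstring only, declarations byte-identical.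
Edition 4 (build-lane export guard, director hodgecm-mathlib s189): ONE import added — `HarnessLib.Audit.LibrarySuggestionsDenyListCorCM`,
the operator's 2026-08-23 name-deny-list entry `CorCM` for Lean 4.32's library-suggestion indexers (`SymbolFrequency` ∕ `SineQuaNon`
`exportEntriesFn`), which otherwise fold every local theorem statement of this module at `.olean` write time (measured > 1 700 s ×3
on a check node vs 70 ms with the entry); the entry is inherited by every importer (the S-4δ ∕ S-4 row files).  Declarations again
byte-identical to edition 1; no statement, proof, attribute, option or name changes.

WHAT.  At `(F⁺, F, c̄)`, ranks `N₁ ⊕ N₂` against the LINE `⟨a⟩` (`M := 1`, `J_W := JW a`), a big compatible splitting `s` (at `JW a`),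
a line-indexed splitting family `s₁f` on the `J₁` block and `s₂` on the `J₂` block, under the `V₁`-side see-saw triviality `hχV` and a
homomorphism `θ : U(J⋆)(𝔸_f) →* U(J₁)(𝔸_f)` fixing the centre (`hθ`): the face representation `plugRho := ω_χ ∘ (· ⊕ᶠ 1) ∘ θ` on
`Coinv (ω_f[J₁ ⊕ J₂]|_{U(⟨a⟩)}) χ_W` factorises per occurring central character `ψ` through `q := (plugE ⊗ 1) ∘ q_{ψ̃} ∘ plugPhi` with every
slice in `Hom(ι′ ∘ (rhoVAtLine[J₁] … a ψ̃ ∘ θ), ℚ_ℓ^{ac} ⊗ H¹_ét)` — `exists_factor_slice_mem_omegaHom_plug'`, the `(M i, q i, g)` tail of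
the decomposition package at one label.  The hypotheses of `exists_factor_slice_mem_omegaHom_GS` are discharged here: `plug_hc` (dual
pair), `plug_hzc` (centre, `c = 1`), `plug_he` (`coinvLineCenterEquiv_rep`), `plugPhi_plugRho` (the face identification intertwines
`plugRho` with `(plugRhoV ⊗ 1)` — ONE application of `splitCoinvEquiv_trans_coinvTransportEquiv_symm_rep_comp`; an in-goal rewrite would
re-check the definitional identity `Coinv ((ρ₁ ⊗ ρ₂) ∘ e) = Coinv ((ρ₁ ∘ e) ⊗ (ρ₂ ∘ e))` on the instantiated Weil data, which exceeds the
default `whnf` budget), leaving `hθ`, the splittings, `hχV` and `hf′` to the assembly.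

## References
* [Liu2021] Y. Liu, *Fourier–Jacobi cycles and arithmetic relative trace formula*, Camb. J. Math. 9 (2021) = arXiv:2102.11518:
  proof of Thm. 4.15 (FJcycle.tex l. 2199–2212), Def. 4.11 (l. 2092–2096), App. D §D.1 Steps 2–3 (l. 5219–5221).
* [GelbartRogawski1991] S. Gelbart, J. Rogawski, Invent. Math. 105 (1991), §3.1 p. 454, Prop. 3.1.1 p. 455, Remark p. 457 L4–13.
-/

noncomputable section

/-! ## §1 The G2c data at the adapted split face and the junctions `hc`, `hzc`, `he` -/

namespace Summit.HodgeConjecture.CorCM.Lines.A3Liu418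

open CategoryTheory NumberField IsDedekindDomain
open scoped TensorProduct Classical
open Literature.AlgebraicGeometry.Motives
open Literature.AlgebraicGeometry.ShimuraVarieties.UnitaryCanonicalModel
open Literature.NumberTheory.Automorphic Literature.NumberTheory.Automorphic.UnitaryGroup
open Literature.NumberTheory.Automorphic.Liu2021 Literature.NumberTheory.Automorphic.Liu2021.AppendixC
open Summit.HodgeConjecture.CorCM.Model Summit.HodgeConjecture.CorCM.Model.HComp
open Literature.RepresentationTheory Literature.RepresentationTheory.TwistedCoinv
open Literature.NumberTheory.GelbartRogawski1991 Literature.NumberTheory.GelbartRogawski1991.UnitaryDualPair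
open Literature.NumberTheory.GelbartRogawski1991.UnitaryDualPair.WeilCoinv
open Literature.NumberTheory.Weil1964

section G2cPlug

variable {F : CMField} {ι₁ : F →+* ℂ} {Jstar : Matrix (Fin 2) (Fin 2) F}
  {K₀ : C5.OpenCompactSubgroup ↥(finAdelic (↥(maximalRealSubfield F)) F (IsCMField.complexConj F) 2 Jstar)}
  (S : RecordSystemGS F Jstar ι₁ K₀)
  (hU7ₛ : S.HeckeTranslateDefinedOver) (hLQ : S.IsLevelQuotient) (h4 : 4 ≤ Module.finrank ℚ F) (isoₛ : ℕ → Prop)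
  (ℓ : ℕ) [Fact ℓ.Prime] (ι' : ℂ ≃+* AlgebraicClosure ℚ_[ℓ])
  -- (f1-adapted) data at `(F⁺, F, c̄)`, `M := 1`, `J_W := JW a`
  (N₁ N₂ : ℕ) {n n₁ n₂ : ℕ}
  (eV : Fin (N₁ + N₂) × Fin 1 ≃ Fin n) (e₁ : Fin N₁ × Fin 1 ≃ Fin n₁) (e₂ : Fin N₂ × Fin 1 ≃ Fin n₂)
  (J₁ : Matrix (Fin N₁) (Fin N₁) (F : Type)) (J₂ : Matrix (Fin N₂) (Fin N₂) (F : Type))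
  {T₁ : Matrix (Fin N₁) (Fin N₁) ↥(maximalRealSubfield (F : Type))} {T₂ : Matrix (Fin N₂) (Fin N₂) ↥(maximalRealSubfield (F : Type))}
  {δ : (F : Type)} (hcδ : (IsCMField.complexConj (F : Type)) δ = -δ) (hδ : δ ≠ 0) {d : ↥(maximalRealSubfield (F : Type))} (hd : δ * δ = algebraMap ↥(maximalRealSubfield (F : Type)) (F : Type) d)
  (h₁ : T₁.IsSymm) (h₂ : T₂.IsSymm) (h₁d : IsUnit T₁.det) (h₂d : IsUnit T₂.det) (hVd : IsUnit (finSum N₁ N₂ T₁ T₂).det)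
  (hJ₁ : J₁ = T₁.map (algebraMap ↥(maximalRealSubfield (F : Type)) (F : Type))) (hJ₂ : J₂ = T₂.map (algebraMap ↥(maximalRealSubfield (F : Type)) (F : Type)))
  (a : (↥(maximalRealSubfield (F : Type)))ˣ)
  {s : ↥(adelicPair ↥(maximalRealSubfield (F : Type)) (F : Type) (IsCMField.complexConj (F : Type)) (N₁ + N₂) 1 (finSum N₁ N₂ J₁ J₂) (Def411WeilCarriers.JW ↥(maximalRealSubfield (F : Type)) (F : Type) a)) →*
    adelicMpCont ↥(maximalRealSubfield (F : Type)) (Fin n) (adelicGram ↥(maximalRealSubfield (F : Type)) eV (finSum N₁ N₂ T₁ T₂) (Def411WeilCarriers.TW ↥(maximalRealSubfield (F : Type)) a))}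
  {s₁f : ∀ b : (↥(maximalRealSubfield (F : Type)))ˣ, ↥(adelicPair ↥(maximalRealSubfield (F : Type)) (F : Type) (IsCMField.complexConj (F : Type)) N₁ 1 J₁ (Def411WeilCarriers.JW ↥(maximalRealSubfield (F : Type)) (F : Type) b)) →*
    adelicMpCont ↥(maximalRealSubfield (F : Type)) (Fin n₁) (adelicGram ↥(maximalRealSubfield (F : Type)) e₁ T₁ (Def411WeilCarriers.TW ↥(maximalRealSubfield (F : Type)) b))}
  {s₂ : ↥(adelicPair ↥(maximalRealSubfield (F : Type)) (F : Type) (IsCMField.complexConj (F : Type)) N₂ 1 J₂ (Def411WeilCarriers.JW ↥(maximalRealSubfield (F : Type)) (F : Type) a)) →*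
    adelicMpCont ↥(maximalRealSubfield (F : Type)) (Fin n₂) (adelicGram ↥(maximalRealSubfield (F : Type)) e₂ T₂ (Def411WeilCarriers.TW ↥(maximalRealSubfield (F : Type)) a))}
  (hs : (splittingDatum ↥(maximalRealSubfield (F : Type)) (F : Type) (IsCMField.complexConj (F : Type)) (N₁ + N₂) 1 eV (finSum N₁ N₂ J₁ J₂) (Def411WeilCarriers.JW ↥(maximalRealSubfield (F : Type)) (F : Type) a) hcδ hδ hd
    (isSymm_finSum h₁ h₂) (Def411WeilCarriers.isSymm_TW ↥(maximalRealSubfield (F : Type)) a) hVd (Def411WeilCarriers.isUnit_det_TW ↥(maximalRealSubfield (F : Type)) a)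
    (finSum_eq_map_finSum ↥(maximalRealSubfield (F : Type)) (F : Type) N₁ N₂ J₁ J₂ hJ₁ hJ₂) (Def411WeilCarriers.JW_eq ↥(maximalRealSubfield (F : Type)) (F : Type) a)).IsCompatible s)
  (hs₁f : ∀ b : (↥(maximalRealSubfield (F : Type)))ˣ, (splittingDatum ↥(maximalRealSubfield (F : Type)) (F : Type) (IsCMField.complexConj (F : Type)) N₁ 1 e₁ J₁ (Def411WeilCarriers.JW ↥(maximalRealSubfield (F : Type)) (F : Type) b) hcδ hδ hd h₁
    (Def411WeilCarriers.isSymm_TW ↥(maximalRealSubfield (F : Type)) b) h₁d (Def411WeilCarriers.isUnit_det_TW ↥(maximalRealSubfield (F : Type)) b) hJ₁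
    (Def411WeilCarriers.JW_eq ↥(maximalRealSubfield (F : Type)) (F : Type) b)).IsCompatible (s₁f b))
  (hs₂ : (splittingDatum ↥(maximalRealSubfield (F : Type)) (F : Type) (IsCMField.complexConj (F : Type)) N₂ 1 e₂ J₂ (Def411WeilCarriers.JW ↥(maximalRealSubfield (F : Type)) (F : Type) a) hcδ hδ hd h₂
    (Def411WeilCarriers.isSymm_TW ↥(maximalRealSubfield (F : Type)) a) h₂d (Def411WeilCarriers.isUnit_det_TW ↥(maximalRealSubfield (F : Type)) a) hJ₂
    (Def411WeilCarriers.JW_eq ↥(maximalRealSubfield (F : Type)) (F : Type) a)).IsCompatible s₂)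
  (hχV : ∀ g₁ : ↥(adelic ↥(maximalRealSubfield (F : Type)) (F : Type) (IsCMField.complexConj (F : Type)) N₁ J₁), mpSeesawCharLeft ↥(maximalRealSubfield (F : Type)) (F : Type) (IsCMField.complexConj (F : Type)) N₁ N₂ 1 eV e₁ e₂ J₁ J₂ (Def411WeilCarriers.JW ↥(maximalRealSubfield (F : Type)) (F : Type) a) hcδ hδ hd h₁ h₂ (Def411WeilCarriers.isSymm_TW ↥(maximalRealSubfield (F : Type)) a) h₁d h₂d (Def411WeilCarriers.isUnit_det_TW ↥(maximalRealSubfield (F : Type)) a) hVd hJ₁ hJ₂ (Def411WeilCarriers.JW_eq ↥(maximalRealSubfield (F : Type)) (F : Type) a) hs (hs₁f a) hs₂ ((g₁, 1), 1) = 1)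
  (χface : Def411WeilCarriers.Chi ↥(maximalRealSubfield (F : Type)) (F : Type) (IsCMField.complexConj (F : Type)))
  (θ : ↥(finAdelic (↥(maximalRealSubfield F)) F (IsCMField.complexConj F) 2 Jstar) →* ↥(finAdelic ↥(maximalRealSubfield (F : Type)) (F : Type) (IsCMField.complexConj (F : Type)) N₁ J₁))

/-- the `J₁`-block Weil module as an `E¹(𝔸_f)`-representation THROUGH the line ((f1′) currency). [cite: Liu2021, App. D §D.1 Step 3 (l. 5221)] -/
def plugRho₁ : Representation ℂ ↥(finAdelicOne ↥(maximalRealSubfield (F : Type)) (F : Type) (IsCMField.complexConj (F : Type))) (FinSB ↥(maximalRealSubfield (F : Type)) (Fin N₁ × Fin 1)) :=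
  (finPairRepW ↥(maximalRealSubfield (F : Type)) (F : Type) (IsCMField.complexConj (F : Type)) N₁ 1 e₁ J₁ (Def411WeilCarriers.JW ↥(maximalRealSubfield (F : Type)) (F : Type) a) hcδ hδ hd h₁ (Def411WeilCarriers.isSymm_TW ↥(maximalRealSubfield (F : Type)) a) h₁d (Def411WeilCarriers.isUnit_det_TW ↥(maximalRealSubfield (F : Type)) a) hJ₁ (Def411WeilCarriers.JW_eq ↥(maximalRealSubfield (F : Type)) (F : Type) a) (hs₁f a)).comp (Def411WeilCarriers.lineCenterEquiv ↥(maximalRealSubfield (F : Type)) (F : Type) (IsCMField.complexConj (F : Type)) a).toMonoidHom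

/-- the `J₂`-block Weil module as an `E¹(𝔸_f)`-representation through the line. [cite: Liu2021, App. D §D.1 Step 3 (l. 5221)] -/
def plugRho₂ : Representation ℂ ↥(finAdelicOne ↥(maximalRealSubfield (F : Type)) (F : Type) (IsCMField.complexConj (F : Type))) (FinSB ↥(maximalRealSubfield (F : Type)) (Fin N₂ × Fin 1)) :=
  (finPairRepW ↥(maximalRealSubfield (F : Type)) (F : Type) (IsCMField.complexConj (F : Type)) N₂ 1 e₂ J₂ (Def411WeilCarriers.JW ↥(maximalRealSubfield (F : Type)) (F : Type) a) hcδ hδ hd h₂ (Def411WeilCarriers.isSymm_TW ↥(maximalRealSubfield (F : Type)) a) h₂d (Def411WeilCarriers.isUnit_det_TW ↥(maximalRealSubfield (F : Type)) a) hJ₂ (Def411WeilCarriers.JW_eq ↥(maximalRealSubfield (F : Type)) (F : Type) a) hs₂).comp (Def411WeilCarriers.lineCenterEquiv ↥(maximalRealSubfield (F : Type)) (F : Type) (IsCMField.complexConj (F : Type)) a).toMonoidHom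

/-- the diagonal character `χ″ := (χ_W · ξ⁻¹) ∘ lineCenterEquiv a` on `E¹(𝔸_f)` ((f1-adapted)'s twist read through the line).
[cite: GelbartRogawski1991, §3.1 Remark p. 457] -/
def plugChi : ↥(finAdelicOne ↥(maximalRealSubfield (F : Type)) (F : Type) (IsCMField.complexConj (F : Type))) →* ℂˣ :=
  ((Def411WeilCarriers.lineChar ↥(maximalRealSubfield (F : Type)) (F : Type) (IsCMField.complexConj (F : Type)) a χface.1) * (seesawCharW ↥(maximalRealSubfield (F : Type)) (F : Type) (IsCMField.complexConj (F : Type)) N₁ N₂ 1 eV e₁ e₂ J₁ J₂ (Def411WeilCarriers.JW ↥(maximalRealSubfield (F : Type)) (F : Type) a) hcδ hδ hd h₁ h₂ (Def411WeilCarriers.isSymm_TW ↥(maximalRealSubfield (F : Type)) a) h₁d h₂d (Def411WeilCarriers.isUnit_det_TW ↥(maximalRealSubfield (F : Type)) a) hVd hJ₁ hJ₂ (Def411WeilCarriers.JW_eq ↥(maximalRealSubfield (F : Type)) (F : Type) a) hs (hs₁f a) hs₂)⁻¹).comp (Def411WeilCarriers.lineCenterEquiv ↥(maximalRealSubfield (F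 : Type)) (F : Type) (IsCMField.complexConj (F : Type)) a).toMonoidHom

/-- the `U(J⋆)(𝔸_f)`-action on the first factor, `finPairRepV[J₁] ∘ θ`. [cite: Liu2021, proof of Thm. 4.15 (l. 2199–2210)] -/
def plugRhoV : Representation ℂ ↥(finAdelic (↥(maximalRealSubfield F)) F (IsCMField.complexConj F) 2 Jstar) (FinSB ↥(maximalRealSubfield (F : Type)) (Fin N₁ × Fin 1)) :=
  (finPairRepV ↥(maximalRealSubfield (F : Type)) (F : Type) (IsCMField.complexConj (F : Type)) N₁ 1 e₁ J₁ (Def411WeilCarriers.JW ↥(maximalRealSubfield (F : Type)) (F : Type) a) hcδ hδ hd h₁ (Def411WeilCarriers.isSymm_TW ↥(maximalRealSubfield (F : Type)) a) h₁d (Def411WeilCarriers.isUnit_det_TW ↥(maximalRealSubfield (F : Type)) a) hJ₁ (Def411WeilCarriers.JW_eq ↥(maximalRealSubfield (F : Type)) (F : Type) a) (hs₁f a)).comp θ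

/-- THE FACE REPRESENTATION in the adapted split model: `ω_χ ∘ (· ⊕ᶠ 1) ∘ θ` on `Coinv (ω_f[J₁ ⊕ J₂] on U(⟨a⟩)) χ_W`.
[cite: Liu2021, proof of Thm. 4.15 (FJcycle.tex l. 2199)] -/
def plugRho : Representation ℂ ↥(finAdelic (↥(maximalRealSubfield F)) F (IsCMField.complexConj F) 2 Jstar) (Coinv (finPairRepW ↥(maximalRealSubfield (F : Type)) (F : Type) (IsCMField.complexConj (F : Type)) (N₁ + N₂) 1 eV (finSum N₁ N₂ J₁ J₂) (Def411WeilCarriers.JW ↥(maximalRealSubfield (F : Type)) (F : Type) a) hcδ hδ hd (isSymm_finSum h₁ h₂) (Def411WeilCarriers.isSymm_TW ↥(maximalRealSubfield (F : Type)) a) hVd (Def411WeilCarriers.isUnit_det_TW ↥(maximalRealSubfield (F : Type)) a) (finSum_eq_map_finSum ↥(maximalRealSubfield (F : Type)) (F : Type) N₁ N₂ J₁ J₂ hJ₁ hJ₂) (Def411WeilCarriers.JW_eq ↥(maximalRealSubfield (F : Type)) (F : Type) a) hs) (Def411WeilCarriers.lineChar ↥(maximalRealSubfield (F : Type)) (F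 : Type) (IsCMField.complexConj (F : Type)) a χface.1)) :=
  (weilCoinv ↥(maximalRealSubfield (F : Type)) (F : Type) (IsCMField.complexConj (F : Type)) (N₁ + N₂) 1 eV (finSum N₁ N₂ J₁ J₂) (Def411WeilCarriers.JW ↥(maximalRealSubfield (F : Type)) (F : Type) a) hcδ hδ hd
      (isSymm_finSum h₁ h₂) (Def411WeilCarriers.isSymm_TW ↥(maximalRealSubfield (F : Type)) a) hVd (Def411WeilCarriers.isUnit_det_TW ↥(maximalRealSubfield (F : Type)) a)
      (finSum_eq_map_finSum ↥(maximalRealSubfield (F : Type)) (F : Type) N₁ N₂ J₁ J₂ hJ₁ hJ₂) (Def411WeilCarriers.JW_eq ↥(maximalRealSubfield (F : Type)) (F : Type) a) (Def411WeilCarriers.lineChar ↥(maximalRealSubfield (F : Type)) (F : Type) (IsCMField.complexConj (F : Type)) a χface.1) hs).comp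
    ((finAdelicBlockDiag ↥(maximalRealSubfield (F : Type)) (F : Type) (IsCMField.complexConj (F : Type)) N₁ N₂ J₁ J₂).comp
      ((MonoidHom.inl ↥(finAdelic ↥(maximalRealSubfield (F : Type)) (F : Type) (IsCMField.complexConj (F : Type)) N₁ J₁) ↥(finAdelic ↥(maximalRealSubfield (F : Type)) (F : Type) (IsCMField.complexConj (F : Type)) N₂ J₂)).comp θ))

/-- THE IDENTIFICATION `Φ` fed to G2c: (f1-adapted)'s `faceSplitCoinvEquiv` followed by the transport of the acting group along
`lineCenterEquiv a` (`coinvTransportEquiv`⁻¹), ascribed to the `(ρ₁∘e) ⊗ (ρ₂∘e)` spelling (`coinv_tprod_comp`, `rfl`).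
[cite: Liu2021, proof of Thm. 4.15 (FJcycle.tex l. 2199–2210)] -/
def plugPhi :=
  (faceSplitCoinvEquiv ↥(maximalRealSubfield (F : Type)) (F : Type) (IsCMField.complexConj (F : Type)) N₁ N₂ 1 eV e₁ e₂ J₁ J₂ (Def411WeilCarriers.JW ↥(maximalRealSubfield (F : Type)) (F : Type) a) hcδ hδ hd h₁ h₂ (Def411WeilCarriers.isSymm_TW ↥(maximalRealSubfield (F : Type)) a) h₁d h₂d (Def411WeilCarriers.isUnit_det_TW ↥(maximalRealSubfield (F : Type)) a) hVd hJ₁ hJ₂ (Def411WeilCarriers.JW_eq ↥(maximalRealSubfield (F : Type)) (F : Type) a) hs (hs₁f a) hs₂ hχV (Def411WeilCarriers.lineChar ↥(maximalRealSubfield (F : Type)) (F : Type) (IsCMField.complexConj (F : Type)) a χface.1)).trans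
    (coinvTransportEquiv _ ((Def411WeilCarriers.lineChar ↥(maximalRealSubfield (F : Type)) (F : Type) (IsCMField.complexConj (F : Type)) a χface.1) * (seesawCharW ↥(maximalRealSubfield (F : Type)) (F : Type) (IsCMField.complexConj (F : Type)) N₁ N₂ 1 eV e₁ e₂ J₁ J₂ (Def411WeilCarriers.JW ↥(maximalRealSubfield (F : Type)) (F : Type) a) hcδ hδ hd h₁ h₂ (Def411WeilCarriers.isSymm_TW ↥(maximalRealSubfield (F : Type)) a) h₁d h₂d (Def411WeilCarriers.isUnit_det_TW ↥(maximalRealSubfield (F : Type)) a) hVd hJ₁ hJ₂ (Def411WeilCarriers.JW_eq ↥(maximalRealSubfield (F : Type)) (F : Type) a) hs (hs₁f a) hs₂)⁻¹) (Def411WeilCarriers.lineCenterEquiv ↥(maximalRealSubfield (F : Type)) (F : Type) (IsCMField.complexConj (F : Type)) a) (plugChi N₁ N₂ eV e₁ e₂ J₁ J₂ hcδ hδ hd h₁ h₂ h₁d h₂d hVd hJ₁ hJ₂ a hs hs₁f hs₂ χface) (fun _ => rfl)).symm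

/-- the (f1′) identification at the label `ψ̃` of an occurring `ψ`: `Coinv (ω_f[J₁] through the line) ψ̃ ≃ omegaAtLine[J₁] … a ψ̃`
(`coinvLineCenterEquiv`). [cite: Liu2021, Def. 4.11 (l. 2092–2096)] -/
def plugE (ψ : ↥(finAdelicOne ↥(maximalRealSubfield (F : Type)) (F : Type) (IsCMField.complexConj (F : Type))) →* (AlgebraicClosure ℚ_[ℓ])ˣ) {v : AlgebraicClosure ℚ_[ℓ] ⊗[ℚ_[ℓ]] (sec42DataGS S h4 isoₛ).etaleH1Tower ℓ}
    (hv : weightProj (rhoEtCenterGSExt S hU7ₛ hLQ h4 isoₛ ℓ (AlgebraicClosure ℚ_[ℓ])) (exists_finiteIndex_forall_rhoEtCenterGSExt_eq S hU7ₛ hLQ h4 isoₛ ℓ (AlgebraicClosure ℚ_[ℓ])) ψ v ≠ 0) :=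
  Def411WeilCarriers.coinvLineCenterEquiv ↥(maximalRealSubfield (F : Type)) (F : Type) (IsCMField.complexConj (F : Type)) N₁ e₁ J₁ hcδ hδ hd h₁ h₁d hJ₁ hs₁f a (chiOfWeight S hU7ₛ hLQ h4 isoₛ ℓ ι' ψ hv)

/-- the curve-side TARGET representation at the label: `rhoVAtLine[J₁] … a ψ̃ ∘ θ`. [cite: Liu2021, Def. 4.11 (l. 2092–2096)] -/
def plugRho' (ψ : ↥(finAdelicOne ↥(maximalRealSubfield (F : Type)) (F : Type) (IsCMField.complexConj (F : Type))) →* (AlgebraicClosure ℚ_[ℓ])ˣ) {v : AlgebraicClosure ℚ_[ℓ] ⊗[ℚ_[ℓ]] (sec42DataGS S h4 isoₛ).etaleH1Tower ℓ}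
    (hv : weightProj (rhoEtCenterGSExt S hU7ₛ hLQ h4 isoₛ ℓ (AlgebraicClosure ℚ_[ℓ])) (exists_finiteIndex_forall_rhoEtCenterGSExt_eq S hU7ₛ hLQ h4 isoₛ ℓ (AlgebraicClosure ℚ_[ℓ])) ψ v ≠ 0) :
    Representation ℂ ↥(finAdelic (↥(maximalRealSubfield F)) F (IsCMField.complexConj F) 2 Jstar) (Def411WeilCarriers.omegaAtLine ↥(maximalRealSubfield (F : Type)) (F : Type) (IsCMField.complexConj (F : Type)) N₁ e₁ J₁ hcδ hδ hd h₁ h₁d hJ₁ hs₁f a (chiOfWeight S hU7ₛ hLQ h4 isoₛ ℓ ι' ψ hv)) :=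
  (Def411WeilCarriers.rhoVAtLine ↥(maximalRealSubfield (F : Type)) (F : Type) (IsCMField.complexConj (F : Type)) N₁ e₁ J₁ hcδ hδ hd h₁ h₁d hJ₁ hs₁f a (chiOfWeight S hU7ₛ hLQ h4 isoₛ ℓ ι' ψ hv)).comp θ


/-! ### rfl-API of the plug data (`_def` ∕ `_apply`): a consumer rewrites ONE application at a time instead of unfolding a
face-sized term under `whnf`. -/

/-- `plugChi h = (χ_W · ξ⁻¹) (lineCenterEquiv a h)`. [cite: GelbartRogawski1991, §3.1 Prop. 3.1.1 p. 455] -/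
theorem plugChi_apply (h : ↥(finAdelicOne ↥(maximalRealSubfield (F : Type)) (F : Type) (IsCMField.complexConj (F : Type)))) :
    plugChi N₁ N₂ eV e₁ e₂ J₁ J₂ hcδ hδ hd h₁ h₂ h₁d h₂d hVd hJ₁ hJ₂ a hs hs₁f hs₂ χface h =
      (((Def411WeilCarriers.lineChar ↥(maximalRealSubfield (F : Type)) (F : Type) (IsCMField.complexConj (F : Type)) a χface.1) * (seesawCharW ↥(maximalRealSubfield (F : Type)) (F : Type) (IsCMField.complexConj (F : Type)) N₁ N₂ 1 eV e₁ e₂ J₁ J₂ (Def411WeilCarriers.JW ↥(maximalRealSubfield (F : Type)) (F : Type) a) hcδ hδ hd h₁ h₂ (Def411WeilCarriers.isSymm_TW ↥(maximalRealSubfield (F : Type)) a) h₁d h₂d (Def411WeilCarriers.isUnit_det_TW ↥(maximalRealSubfield (F : Type)) a) hVd hJ₁ hJ₂ (Def411WeilCarriers.JW_eq ↥(maximalRealSubfield (F : Type)) (F : Type) a) hs (hs₁f a) hs₂)⁻¹).comp (Def411WeilCarriers.lineCenterEquiv ↥(maximalRealSubfield (F : Type)) (F : Type) (IsCMField.complexConj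 (F : Type)) a).toMonoidHom) h := rfl

/-- `plugRhoV θ = ω_f^{V₁}(s₁)|_{U(J₁)} ∘ θ` (definitional). [cite: GelbartRogawski1991, §3.1 Prop. 3.1.1 p. 455] -/
theorem plugRhoV_def :
    plugRhoV N₁ e₁ J₁ hcδ hδ hd h₁ h₁d hJ₁ a hs₁f θ =
      (finPairRepV ↥(maximalRealSubfield (F : Type)) (F : Type) (IsCMField.complexConj (F : Type)) N₁ 1 e₁ J₁ (Def411WeilCarriers.JW ↥(maximalRealSubfield (F : Type)) (F : Type) a) hcδ hδ hd h₁ (Def411WeilCarriers.isSymm_TW ↥(maximalRealSubfield (F : Type)) a) h₁d (Def411WeilCarriers.isUnit_det_TW ↥(maximalRealSubfield (F : Type)) a) hJ₁ (Def411WeilCarriers.JW_eq ↥(maximalRealSubfield (F : Type)) (F : Type) a) (hs₁f a)).comp θ := rfl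

/-- `plugRhoV θ g = ω_f^{V₁}(s₁)(θ g, 1)`. [cite: GelbartRogawski1991, §3.1 Prop. 3.1.1 p. 455] -/
theorem plugRhoV_apply (g : ↥(finAdelic (↥(maximalRealSubfield F)) F (IsCMField.complexConj F) 2 Jstar)) :
    plugRhoV N₁ e₁ J₁ hcδ hδ hd h₁ h₁d hJ₁ a hs₁f θ g =
      (finPairRepV ↥(maximalRealSubfield (F : Type)) (F : Type) (IsCMField.complexConj (F : Type)) N₁ 1 e₁ J₁ (Def411WeilCarriers.JW ↥(maximalRealSubfield (F : Type)) (F : Type) a) hcδ hδ hd h₁ (Def411WeilCarriers.isSymm_TW ↥(maximalRealSubfield (F : Type)) a) h₁d (Def411WeilCarriers.isUnit_det_TW ↥(maximalRealSubfield (F : Type)) a) hJ₁ (Def411WeilCarriers.JW_eq ↥(maximalRealSubfield (F : Type)) (F : Type) a) (hs₁f a)) (θ g) := rfl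

/-- `plugRho θ = ω_χ ∘ (· ⊕ᶠ 1) ∘ θ` (definitional). [cite: Liu2021, proof of Thm. 4.15 (FJcycle.tex l. 2199–2210); App. D §D.1 Step 3 (l. 5221)] -/
theorem plugRho_def :
    plugRho N₁ N₂ eV J₁ J₂ hcδ hδ hd h₁ h₂ hVd hJ₁ hJ₂ a hs χface θ =
      (weilCoinv ↥(maximalRealSubfield (F : Type)) (F : Type) (IsCMField.complexConj (F : Type)) (N₁ + N₂) 1 eV (finSum N₁ N₂ J₁ J₂) (Def411WeilCarriers.JW ↥(maximalRealSubfield (F : Type)) (F : Type) a) hcδ hδ hd (isSymm_finSum h₁ h₂) (Def411WeilCarriers.isSymm_TW ↥(maximalRealSubfield (F : Type)) a) hVd (Def411WeilCarriers.isUnit_det_TW ↥(maximalRealSubfield (F : Type)) a) (finSum_eq_map_finSum ↥(maximalRealSubfield (F : Type)) (F : Type) N₁ N₂ J₁ J₂ hJ₁ hJ₂) (Def411WeilCarriers.JW_eq ↥(maximalRealSubfield (F : Type)) (F : Type) a) (Def411WeilCarriers.lineChar ↥(maximalRealSubfield (F : Type)) (F : Type) (IsCMField.complexConj (F : Type)) a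 χface.1) hs).comp ((finAdelicBlockDiag ↥(maximalRealSubfield (F : Type)) (F : Type) (IsCMField.complexConj (F : Type)) N₁ N₂ J₁ J₂).comp ((MonoidHom.inl ↥(finAdelic ↥(maximalRealSubfield (F : Type)) (F : Type) (IsCMField.complexConj (F : Type)) N₁ J₁) ↥(finAdelic ↥(maximalRealSubfield (F : Type)) (F : Type) (IsCMField.complexConj (F : Type)) N₂ J₂)).comp θ)) := rfl

/-- `plugRho θ u = ω_χ (θ u ⊕ᶠ 1)` on the face coinvariants. [cite: Liu2021, proof of Thm. 4.15 (FJcycle.tex l. 2199–2210); App. D §D.1 Step 3 (l. 5221)] -/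
theorem plugRho_apply (u : ↥(finAdelic (↥(maximalRealSubfield F)) F (IsCMField.complexConj F) 2 Jstar)) :
    plugRho N₁ N₂ eV J₁ J₂ hcδ hδ hd h₁ h₂ hVd hJ₁ hJ₂ a hs χface θ u =
      weilCoinv ↥(maximalRealSubfield (F : Type)) (F : Type) (IsCMField.complexConj (F : Type)) (N₁ + N₂) 1 eV (finSum N₁ N₂ J₁ J₂) (Def411WeilCarriers.JW ↥(maximalRealSubfield (F : Type)) (F : Type) a) hcδ hδ hd (isSymm_finSum h₁ h₂) (Def411WeilCarriers.isSymm_TW ↥(maximalRealSubfield (F : Type)) a) hVd (Def411WeilCarriers.isUnit_det_TW ↥(maximalRealSubfield (F : Type)) a) (finSum_eq_map_finSum ↥(maximalRealSubfield (F : Type)) (F : Type) N₁ N₂ J₁ J₂ hJ₁ hJ₂) (Def411WeilCarriers.JW_eq ↥(maximalRealSubfield (F : Type)) (F : Type) a) (Def411WeilCarriers.lineChar ↥(maximalRealSubfield (F : Type)) (F : Type) (IsCMField.complexConj (F : Type)) a χface.1) hs (finAdelicBlockDiag ↥(maximalRealSubfield (F : Type)) (F : Type) (IsCMField.complexConj (F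 : Type)) N₁ N₂ J₁ J₂ (θ u, 1)) := rfl

/-- `plugPhi = faceSplitCoinvEquiv ≫ (coinvTransportEquiv …)⁻¹` (definitional). [cite: Liu2021, proof of Thm. 4.15 (FJcycle.tex l. 2199–2210); App. D §D.1 Step 3 (l. 5221)] -/
theorem plugPhi_def :
    plugPhi N₁ N₂ eV e₁ e₂ J₁ J₂ hcδ hδ hd h₁ h₂ h₁d h₂d hVd hJ₁ hJ₂ a hs hs₁f hs₂ hχV χface =
      (faceSplitCoinvEquiv ↥(maximalRealSubfield (F : Type)) (F : Type) (IsCMField.complexConj (F : Type)) N₁ N₂ 1 eV e₁ e₂ J₁ J₂ (Def411WeilCarriers.JW ↥(maximalRealSubfield (F : Type)) (F : Type) a) hcδ hδ hd h₁ h₂ (Def411WeilCarriers.isSymm_TW ↥(maximalRealSubfield (F : Type)) a) h₁d h₂d (Def411WeilCarriers.isUnit_det_TW ↥(maximalRealSubfield (F : Type)) a) hVd hJ₁ hJ₂ (Def411WeilCarriers.JW_eq ↥(maximalRealSubfield (F : Type)) (F : Type) a) hs (hs₁f a) hs₂ hχV (Def411WeilCarriers.lineChar ↥(maximalRealSubfield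 (F : Type)) (F : Type) (IsCMField.complexConj (F : Type)) a χface.1)).trans (coinvTransportEquiv _ ((Def411WeilCarriers.lineChar ↥(maximalRealSubfield (F : Type)) (F : Type) (IsCMField.complexConj (F : Type)) a χface.1) * (seesawCharW ↥(maximalRealSubfield (F : Type)) (F : Type) (IsCMField.complexConj (F : Type)) N₁ N₂ 1 eV e₁ e₂ J₁ J₂ (Def411WeilCarriers.JW ↥(maximalRealSubfield (F : Type)) (F : Type) a) hcδ hδ hd h₁ h₂ (Def411WeilCarriers.isSymm_TW ↥(maximalRealSubfield (F : Type)) a) h₁d h₂d (Def411WeilCarriers.isUnit_det_TW ↥(maximalRealSubfield (F : Type)) a) hVd hJ₁ hJ₂ (Def411WeilCarriers.JW_eq ↥(maximalRealSubfield (F : Type)) (F : Type) a) hs (hs₁f a) hs₂)⁻¹) (Def411WeilCarriers.lineCenterEquiv ↥(maximalRealSubfield (F : Type)) (F : Type) (IsCMField.complexConj (F : Type)) a) (plugChi N₁ N₂ eV e₁ e₂ J₁ J₂ hcδ hδ hd h₁ h₂ h₁d h₂d hVd hJ₁ hJ₂ a hs hs₁f hs₂ χface) (fun _ => rfl)).symm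 := rfl

/-- `plugE ψ hv = coinvLineCenterEquiv … a ψ̃` (definitional). [cite: Liu2021, Def. 4.11 (l. 2092–2096)] -/
theorem plugE_def (ψ : ↥(finAdelicOne ↥(maximalRealSubfield (F : Type)) (F : Type) (IsCMField.complexConj (F : Type))) →* (AlgebraicClosure ℚ_[ℓ])ˣ) {v : AlgebraicClosure ℚ_[ℓ] ⊗[ℚ_[ℓ]] (sec42DataGS S h4 isoₛ).etaleH1Tower ℓ} (hv : weightProj (rhoEtCenterGSExt S hU7ₛ hLQ h4 isoₛ ℓ (AlgebraicClosure ℚ_[ℓ])) (exists_finiteIndex_forall_rhoEtCenterGSExt_eq S hU7ₛ hLQ h4 isoₛ ℓ (AlgebraicClosure ℚ_[ℓ])) ψ v ≠ 0) :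
    plugE S hU7ₛ hLQ h4 isoₛ ℓ ι' N₁ e₁ J₁ hcδ hδ hd h₁ h₁d hJ₁ a hs₁f ψ hv =
      Def411WeilCarriers.coinvLineCenterEquiv ↥(maximalRealSubfield (F : Type)) (F : Type) (IsCMField.complexConj (F : Type)) N₁ e₁ J₁ hcδ hδ hd h₁ h₁d hJ₁ hs₁f a (chiOfWeight S hU7ₛ hLQ h4 isoₛ ℓ ι' ψ hv) := rfl

/-- `plugRho' θ ψ hv = rhoVAtLine[J₁] … a ψ̃ ∘ θ` (definitional). [cite: Liu2021, Def. 4.11 (l. 2092–2096)] -/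
theorem plugRho'_def (ψ : ↥(finAdelicOne ↥(maximalRealSubfield (F : Type)) (F : Type) (IsCMField.complexConj (F : Type))) →* (AlgebraicClosure ℚ_[ℓ])ˣ) {v : AlgebraicClosure ℚ_[ℓ] ⊗[ℚ_[ℓ]] (sec42DataGS S h4 isoₛ).etaleH1Tower ℓ} (hv : weightProj (rhoEtCenterGSExt S hU7ₛ hLQ h4 isoₛ ℓ (AlgebraicClosure ℚ_[ℓ])) (exists_finiteIndex_forall_rhoEtCenterGSExt_eq S hU7ₛ hLQ h4 isoₛ ℓ (AlgebraicClosure ℚ_[ℓ])) ψ v ≠ 0) :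
    plugRho' S hU7ₛ hLQ h4 isoₛ ℓ ι' N₁ e₁ J₁ hcδ hδ hd h₁ h₁d hJ₁ a hs₁f θ ψ hv =
      (Def411WeilCarriers.rhoVAtLine ↥(maximalRealSubfield (F : Type)) (F : Type) (IsCMField.complexConj (F : Type)) N₁ e₁ J₁ hcδ hδ hd h₁ h₁d hJ₁ hs₁f a (chiOfWeight S hU7ₛ hLQ h4 isoₛ ℓ ι' ψ hv)).comp θ := rfl

/-- `plugRho' θ ψ hv g = rhoVAtLine[J₁] … a ψ̃ (θ g)`. [cite: Liu2021, Def. 4.11 (l. 2092–2096)] -/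
theorem plugRho'_apply (ψ : ↥(finAdelicOne ↥(maximalRealSubfield (F : Type)) (F : Type) (IsCMField.complexConj (F : Type))) →* (AlgebraicClosure ℚ_[ℓ])ˣ) {v : AlgebraicClosure ℚ_[ℓ] ⊗[ℚ_[ℓ]] (sec42DataGS S h4 isoₛ).etaleH1Tower ℓ} (hv : weightProj (rhoEtCenterGSExt S hU7ₛ hLQ h4 isoₛ ℓ (AlgebraicClosure ℚ_[ℓ])) (exists_finiteIndex_forall_rhoEtCenterGSExt_eq S hU7ₛ hLQ h4 isoₛ ℓ (AlgebraicClosure ℚ_[ℓ])) ψ v ≠ 0) (g : ↥(finAdelic (↥(maximalRealSubfield F)) F (IsCMField.complexConj F) 2 Jstar)) :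
    plugRho' S hU7ₛ hLQ h4 isoₛ ℓ ι' N₁ e₁ J₁ hcδ hδ hd h₁ h₁d hJ₁ a hs₁f θ ψ hv g =
      (Def411WeilCarriers.rhoVAtLine ↥(maximalRealSubfield (F : Type)) (F : Type) (IsCMField.complexConj (F : Type)) N₁ e₁ J₁ hcδ hδ hd h₁ h₁d hJ₁ hs₁f a (chiOfWeight S hU7ₛ hLQ h4 isoₛ ℓ ι' ψ hv)) (θ g) := rfl

/-- **hc**: the `U(J⋆)`-action on the first factor commutes with the `E¹`-action (dual pair). [cite: GelbartRogawski1991, §3.1 Prop. 3.1.1] -/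
theorem plug_hc (g : ↥(finAdelic (↥(maximalRealSubfield F)) F (IsCMField.complexConj F) 2 Jstar)) (h : ↥(finAdelicOne ↥(maximalRealSubfield (F : Type)) (F : Type) (IsCMField.complexConj (F : Type)))) :
    Commute (plugRhoV N₁ e₁ J₁ hcδ hδ hd h₁ h₁d hJ₁ a hs₁f θ g) (plugRho₁ N₁ e₁ J₁ hcδ hδ hd h₁ h₁d hJ₁ a hs₁f h) :=
  Def411WeilCarriers.commute_finPairRepV_finPairRepW_comp_lineCenterEquiv ↥(maximalRealSubfield (F : Type)) (F : Type) (IsCMField.complexConj (F : Type)) N₁ e₁ J₁ hcδ hδ hd h₁ h₁d hJ₁ hs₁f a (θ g) h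

/-- **hzc** (`c = 1`): the centre of `U(J⋆)(𝔸_f)` acts on the first factor like `E¹` through the line (`hθ` + ★ `finPairRepV_finAdelicCenter`).
[cite: GelbartRogawski1991, §3.1 p. 454] -/
theorem plug_hzc (hθ : ∀ z : ↥(finAdelicOne ↥(maximalRealSubfield (F : Type)) (F : Type) (IsCMField.complexConj (F : Type))), θ (finAdelicCenter ↥(maximalRealSubfield (F : Type)) (F : Type) (IsCMField.complexConj (F : Type)) 2 Jstar z) = finAdelicCenter ↥(maximalRealSubfield (F : Type)) (F : Type) (IsCMField.complexConj (F : Type)) N₁ J₁ z)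
    (z : ↥(finAdelicOne ↥(maximalRealSubfield (F : Type)) (F : Type) (IsCMField.complexConj (F : Type)))) (v : FinSB ↥(maximalRealSubfield (F : Type)) (Fin N₁ × Fin 1)) :
    plugRhoV N₁ e₁ J₁ hcδ hδ hd h₁ h₁d hJ₁ a hs₁f θ (finAdelicCenter ↥(maximalRealSubfield (F : Type)) (F : Type) (IsCMField.complexConj (F : Type)) 2 Jstar z) v = plugRho₁ N₁ e₁ J₁ hcδ hδ hd h₁ h₁d hJ₁ a hs₁f z v := by
  rw [plugRhoV, MonoidHom.comp_apply, hθ, finPairRepV_finAdelicCenter]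
  rfl

/-- **he**: (f1′) equivariance at `k := θ g` (`coinvLineCenterEquiv_rep`). [cite: Liu2021, App. D §D.1 Steps 2–3 (l. 5219–5221)] -/
theorem plug_he (ψ : ↥(finAdelicOne ↥(maximalRealSubfield (F : Type)) (F : Type) (IsCMField.complexConj (F : Type))) →* (AlgebraicClosure ℚ_[ℓ])ˣ) {v : AlgebraicClosure ℚ_[ℓ] ⊗[ℚ_[ℓ]] (sec42DataGS S h4 isoₛ).etaleH1Tower ℓ}
    (hv : weightProj (rhoEtCenterGSExt S hU7ₛ hLQ h4 isoₛ ℓ (AlgebraicClosure ℚ_[ℓ])) (exists_finiteIndex_forall_rhoEtCenterGSExt_eq S hU7ₛ hLQ h4 isoₛ ℓ (AlgebraicClosure ℚ_[ℓ])) ψ v ≠ 0) (g : ↥(finAdelic (↥(maximalRealSubfield F)) F (IsCMField.complexConj F) 2 Jstar))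
    (x : Coinv (plugRho₁ N₁ e₁ J₁ hcδ hδ hd h₁ h₁d hJ₁ a hs₁f) (psiTilde ℓ ι' ψ)) :
    plugE S hU7ₛ hLQ h4 isoₛ ℓ ι' N₁ e₁ J₁ hcδ hδ hd h₁ h₁d hJ₁ a hs₁f ψ hv (rep (psiTilde ℓ ι' ψ) (plugRhoV N₁ e₁ J₁ hcδ hδ hd h₁ h₁d hJ₁ a hs₁f θ) (plug_hc N₁ e₁ J₁ hcδ hδ hd h₁ h₁d hJ₁ a hs₁f θ) g x) =
      plugRho' S hU7ₛ hLQ h4 isoₛ ℓ ι' N₁ e₁ J₁ hcδ hδ hd h₁ h₁d hJ₁ a hs₁f θ ψ hv g (plugE S hU7ₛ hLQ h4 isoₛ ℓ ι' N₁ e₁ J₁ hcδ hδ hd h₁ h₁d hJ₁ a hs₁f ψ hv x) :=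
  Def411WeilCarriers.coinvLineCenterEquiv_rep ↥(maximalRealSubfield (F : Type)) (F : Type) (IsCMField.complexConj (F : Type)) N₁ e₁ J₁ hcδ hδ hd h₁ h₁d hJ₁ hs₁f a (chiOfWeight S hU7ₛ hLQ h4 isoₛ ℓ ι' ψ hv) (θ g) x

/-- **G2c PLUGGED (per occurring `ψ`) at the adapted split face**: for every `f′ ∈ Hom_{U(J⋆)(𝔸_f)}(ι′ ∘ (ω_χ ∘ (·⊕ᶠ1) ∘ θ), ℚ_ℓ^{ac} ⊗ H¹_ét)`,
`p_ψ ∘ f′ = g ∘ q` with `q := (coinvLineCenterEquiv ⊗ 1) ∘ q_{ψ̃} ∘ Φ` and every slice `x ↦ g (x ⊗ m)` in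
`Hom(ι′ ∘ (rhoVAtLine[J₁] … a ψ̃ ∘ θ), ℚ_ℓ^{ac} ⊗ H¹_ét)` — the `(M i, q i, g)` tail of `DecompositionAtFace` with
`M i := Coinv (ω_f[J₂] through ⟨a⟩) (χ″·ψ̃⁻¹)`.  Remaining inputs: `θ`/`hθ` (frame: `finAdelicCongr gstar`, ★-HOME
`finAdelicCongr_finAdelicCenter`), the splittings, `hχV` (= `stub_R`), `hf′`, and the ONE `rfl`-level junction `hΦ` (statement fixed here:
`plugPhi` intertwines `plugRho g` with `rep plugChi ((plugRhoV θ) ⊗ 1) g`; road: `faceSplitCoinvEquiv_weilCoinv` at `θ g` + `coinvTransportEquiv_symm_rep`,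
then `(σ₁ ∘ θ) ⊗ 1` at `g` = `σ₁ ⊗ 1` at `θ g` on representatives via `mk_surjective`/`rep_mk` — the bare `rfl` after the rewrites exceeds 200 k `whnf`). [cite: Liu2021, proof of Thm. 4.15 (FJcycle.tex l. 2199–2212); App. D §D.1 Step 3 (l. 5221)] -/
theorem exists_factor_slice_mem_omegaHom_plug
    (hθ : ∀ z : ↥(finAdelicOne ↥(maximalRealSubfield (F : Type)) (F : Type) (IsCMField.complexConj (F : Type))), θ (finAdelicCenter ↥(maximalRealSubfield (F : Type)) (F : Type) (IsCMField.complexConj (F : Type)) 2 Jstar z) = finAdelicCenter ↥(maximalRealSubfield (F : Type)) (F : Type) (IsCMField.complexConj (F : Type)) N₁ J₁ z)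
    (hΦ : ∀ (g : ↥(finAdelic (↥(maximalRealSubfield F)) F (IsCMField.complexConj F) 2 Jstar)) (w : Coinv (finPairRepW ↥(maximalRealSubfield (F : Type)) (F : Type) (IsCMField.complexConj (F : Type)) (N₁ + N₂) 1 eV (finSum N₁ N₂ J₁ J₂) (Def411WeilCarriers.JW ↥(maximalRealSubfield (F : Type)) (F : Type) a) hcδ hδ hd (isSymm_finSum h₁ h₂) (Def411WeilCarriers.isSymm_TW ↥(maximalRealSubfield (F : Type)) a) hVd (Def411WeilCarriers.isUnit_det_TW ↥(maximalRealSubfield (F : Type)) a) (finSum_eq_map_finSum ↥(maximalRealSubfield (F : Type)) (F : Type) N₁ N₂ J₁ J₂ hJ₁ hJ₂) (Def411WeilCarriers.JW_eq ↥(maximalRealSubfield (F : Type)) (F : Type) a) hs) (Def411WeilCarriers.lineChar ↥(maximalRealSubfield (F : Type)) (F : Type) (IsCMField.complexConj (F : Type)) a χface.1)),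
      plugPhi N₁ N₂ eV e₁ e₂ J₁ J₂ hcδ hδ hd h₁ h₂ h₁d h₂d hVd hJ₁ hJ₂ a hs hs₁f hs₂ hχV χface (plugRho N₁ N₂ eV J₁ J₂ hcδ hδ hd h₁ h₂ hVd hJ₁ hJ₂ a hs χface θ g w) =
        rep (plugChi N₁ N₂ eV e₁ e₂ J₁ J₂ hcδ hδ hd h₁ h₂ h₁d h₂d hVd hJ₁ hJ₂ a hs hs₁f hs₂ χface) _
          (commute_tprod_one (plugRho₁ N₁ e₁ J₁ hcδ hδ hd h₁ h₁d hJ₁ a hs₁f) (plugRho₂ N₂ e₂ J₂ hcδ hδ hd h₂ h₂d hJ₂ a hs₂) (plugRhoV N₁ e₁ J₁ hcδ hδ hd h₁ h₁d hJ₁ a hs₁f θ) (plug_hc N₁ e₁ J₁ hcδ hδ hd h₁ h₁d hJ₁ a hs₁f θ)) g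
          (plugPhi N₁ N₂ eV e₁ e₂ J₁ J₂ hcδ hδ hd h₁ h₂ h₁d h₂d hVd hJ₁ hJ₂ a hs hs₁f hs₂ hχV χface w))
    (ψ : ↥(finAdelicOne ↥(maximalRealSubfield (F : Type)) (F : Type) (IsCMField.complexConj (F : Type))) →* (AlgebraicClosure ℚ_[ℓ])ˣ) {v : AlgebraicClosure ℚ_[ℓ] ⊗[ℚ_[ℓ]] (sec42DataGS S h4 isoₛ).etaleH1Tower ℓ}
    (hv : weightProj (rhoEtCenterGSExt S hU7ₛ hLQ h4 isoₛ ℓ (AlgebraicClosure ℚ_[ℓ])) (exists_finiteIndex_forall_rhoEtCenterGSExt_eq S hU7ₛ hLQ h4 isoₛ ℓ (AlgebraicClosure ℚ_[ℓ])) ψ v ≠ 0)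
    {f' : Coinv (finPairRepW ↥(maximalRealSubfield (F : Type)) (F : Type) (IsCMField.complexConj (F : Type)) (N₁ + N₂) 1 eV (finSum N₁ N₂ J₁ J₂) (Def411WeilCarriers.JW ↥(maximalRealSubfield (F : Type)) (F : Type) a) hcδ hδ hd (isSymm_finSum h₁ h₂) (Def411WeilCarriers.isSymm_TW ↥(maximalRealSubfield (F : Type)) a) hVd (Def411WeilCarriers.isUnit_det_TW ↥(maximalRealSubfield (F : Type)) a) (finSum_eq_map_finSum ↥(maximalRealSubfield (F : Type)) (F : Type) N₁ N₂ J₁ J₂ hJ₁ hJ₂) (Def411WeilCarriers.JW_eq ↥(maximalRealSubfield (F : Type)) (F : Type) a) hs) (Def411WeilCarriers.lineChar ↥(maximalRealSubfield (F : Type)) (F : Type) (IsCMField.complexConj (F : Type)) a χface.1) →ₛₗ[(ι' : ℂ →+* AlgebraicClosure ℚ_[ℓ])] AlgebraicClosure ℚ_[ℓ] ⊗[ℚ_[ℓ]] (sec42DataGS S h4 isoₛ).etaleH1Tower ℓ}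
    (hf' : f' ∈ (etaleHeckeDatumGS S hU7ₛ hLQ h4 isoₛ ℓ).omegaHom ι' (plugRho N₁ N₂ eV J₁ J₂ hcδ hδ hd h₁ h₂ hVd hJ₁ hJ₂ a hs χface θ)) :
    ∃ g : Def411WeilCarriers.omegaAtLine ↥(maximalRealSubfield (F : Type)) (F : Type) (IsCMField.complexConj (F : Type)) N₁ e₁ J₁ hcδ hδ hd h₁ h₁d hJ₁ hs₁f a (chiOfWeight S hU7ₛ hLQ h4 isoₛ ℓ ι' ψ hv) ⊗[ℂ]
          Coinv (plugRho₂ N₂ e₂ J₂ hcδ hδ hd h₂ h₂d hJ₂ a hs₂) (plugChi N₁ N₂ eV e₁ e₂ J₁ J₂ hcδ hδ hd h₁ h₂ h₁d h₂d hVd hJ₁ hJ₂ a hs hs₁f hs₂ χface * (psiTilde ℓ ι' ψ)⁻¹) →ₛₗ[(ι' : ℂ →+* AlgebraicClosure ℚ_[ℓ])]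
        AlgebraicClosure ℚ_[ℓ] ⊗[ℚ_[ℓ]] (sec42DataGS S h4 isoₛ).etaleH1Tower ℓ,
      (∀ w, weightProj (rhoEtCenterGSExt S hU7ₛ hLQ h4 isoₛ ℓ (AlgebraicClosure ℚ_[ℓ])) (exists_finiteIndex_forall_rhoEtCenterGSExt_eq S hU7ₛ hLQ h4 isoₛ ℓ (AlgebraicClosure ℚ_[ℓ])) ψ (f' w) =
        g (TensorProduct.congr (plugE S hU7ₛ hLQ h4 isoₛ ℓ ι' N₁ e₁ J₁ hcδ hδ hd h₁ h₁d hJ₁ a hs₁f ψ hv) (LinearEquiv.refl ℂ (Coinv (plugRho₂ N₂ e₂ J₂ hcδ hδ hd h₂ h₂d hJ₂ a hs₂) (plugChi N₁ N₂ eV e₁ e₂ J₁ J₂ hcδ hδ hd h₁ h₂ h₁d h₂d hVd hJ₁ hJ₂ a hs hs₁f hs₂ χface * (psiTilde ℓ ι' ψ)⁻¹)))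
          (coinvTprodQuot (plugRho₁ N₁ e₁ J₁ hcδ hδ hd h₁ h₁d hJ₁ a hs₁f) (plugRho₂ N₂ e₂ J₂ hcδ hδ hd h₂ h₂d hJ₂ a hs₂) (plugChi N₁ N₂ eV e₁ e₂ J₁ J₂ hcδ hδ hd h₁ h₂ h₁d h₂d hVd hJ₁ hJ₂ a hs hs₁f hs₂ χface) (psiTilde ℓ ι' ψ) (plugPhi N₁ N₂ eV e₁ e₂ J₁ J₂ hcδ hδ hd h₁ h₂ h₁d h₂d hVd hJ₁ hJ₂ a hs hs₁f hs₂ hχV χface w)))) ∧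
      ∀ m : Coinv (plugRho₂ N₂ e₂ J₂ hcδ hδ hd h₂ h₂d hJ₂ a hs₂) (plugChi N₁ N₂ eV e₁ e₂ J₁ J₂ hcδ hδ hd h₁ h₂ h₁d h₂d hVd hJ₁ hJ₂ a hs hs₁f hs₂ χface * (psiTilde ℓ ι' ψ)⁻¹),
        g.comp ((TensorProduct.mk ℂ (Def411WeilCarriers.omegaAtLine ↥(maximalRealSubfield (F : Type)) (F : Type) (IsCMField.complexConj (F : Type)) N₁ e₁ J₁ hcδ hδ hd h₁ h₁d hJ₁ hs₁f a (chiOfWeight S hU7ₛ hLQ h4 isoₛ ℓ ι' ψ hv))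
          (Coinv (plugRho₂ N₂ e₂ J₂ hcδ hδ hd h₂ h₂d hJ₂ a hs₂) (plugChi N₁ N₂ eV e₁ e₂ J₁ J₂ hcδ hδ hd h₁ h₂ h₁d h₂d hVd hJ₁ hJ₂ a hs hs₁f hs₂ χface * (psiTilde ℓ ι' ψ)⁻¹))).flip m) ∈
          (etaleHeckeDatumGS S hU7ₛ hLQ h4 isoₛ ℓ).omegaHom ι' (plugRho' S hU7ₛ hLQ h4 isoₛ ℓ ι' N₁ e₁ J₁ hcδ hδ hd h₁ h₁d hJ₁ a hs₁f θ ψ hv) :=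
  exists_factor_slice_mem_omegaHom_GS S hU7ₛ hLQ h4 isoₛ ℓ ι' (plugRho₁ N₁ e₁ J₁ hcδ hδ hd h₁ h₁d hJ₁ a hs₁f) (plugRho₂ N₂ e₂ J₂ hcδ hδ hd h₂ h₂d hJ₂ a hs₂) (plugChi N₁ N₂ eV e₁ e₂ J₁ J₂ hcδ hδ hd h₁ h₂ h₁d h₂d hVd hJ₁ hJ₂ a hs hs₁f hs₂ χface)
    (plugRhoV N₁ e₁ J₁ hcδ hδ hd h₁ h₁d hJ₁ a hs₁f θ) (plugRho N₁ N₂ eV J₁ J₂ hcδ hδ hd h₁ h₂ hVd hJ₁ hJ₂ a hs χface θ) (plugPhi N₁ N₂ eV e₁ e₂ J₁ J₂ hcδ hδ hd h₁ h₂ h₁d h₂d hVd hJ₁ hJ₂ a hs hs₁f hs₂ hχV χface) (plugRho' S hU7ₛ hLQ h4 isoₛ ℓ ι' N₁ e₁ J₁ hcδ hδ hd h₁ h₁d hJ₁ a hs₁f θ ψ hv) ψ (plugE S hU7ₛ hLQ h4 isoₛ ℓ ι' N₁ e₁ J₁ hcδ hδ hd h₁ h₁d hJ₁ a hs₁f ψ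 hv)
    (plug_hc N₁ e₁ J₁ hcδ hδ hd h₁ h₁d hJ₁ a hs₁f θ) (plug_hzc N₁ e₁ J₁ hcδ hδ hd h₁ h₁d hJ₁ a hs₁f θ hθ) hΦ (plug_he S hU7ₛ hLQ h4 isoₛ ℓ ι' N₁ e₁ J₁ hcδ hδ hd h₁ h₁d hJ₁ a hs₁f θ ψ hv) hf'

end G2cPlug

end Summit.HodgeConjecture.CorCM.Lines.A3Liu418

/-! ## §2 The junction `hΦ` and the fully plugged factorisation -/

namespace Summit.HodgeConjecture.CorCM.Lines.A3Liu418

open CategoryTheory NumberField IsDedekindDomain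
open scoped TensorProduct Classical
open Literature.AlgebraicGeometry.Motives
open Literature.AlgebraicGeometry.ShimuraVarieties.UnitaryCanonicalModel
open Literature.NumberTheory.Automorphic Literature.NumberTheory.Automorphic.UnitaryGroup
open Literature.NumberTheory.Automorphic.Liu2021 Literature.NumberTheory.Automorphic.Liu2021.AppendixC
open Summit.HodgeConjecture.CorCM.Model Summit.HodgeConjecture.CorCM.Model.HComp
open Literature.RepresentationTheory Literature.RepresentationTheory.TwistedCoinv
open Literature.NumberTheory.GelbartRogawski1991 Literature.NumberTheory.GelbartRogawski1991.UnitaryDualPair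
open Literature.NumberTheory.GelbartRogawski1991.UnitaryDualPair.WeilCoinv
open Literature.NumberTheory.Weil1964

section G2cPlugHPhi

variable {F : CMField} {ι₁ : F →+* ℂ} {Jstar : Matrix (Fin 2) (Fin 2) F}
  {K₀ : C5.OpenCompactSubgroup ↥(finAdelic (↥(maximalRealSubfield F)) F (IsCMField.complexConj F) 2 Jstar)}
  (S : RecordSystemGS F Jstar ι₁ K₀)
  (hU7ₛ : S.HeckeTranslateDefinedOver) (hLQ : S.IsLevelQuotient) (h4 : 4 ≤ Module.finrank ℚ F) (isoₛ : ℕ → Prop)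
  (ℓ : ℕ) [Fact ℓ.Prime] (ι' : ℂ ≃+* AlgebraicClosure ℚ_[ℓ])
  -- (f1-adapted) data at `(F⁺, F, c̄)`, `M := 1`, `J_W := JW a`
  (N₁ N₂ : ℕ) {n n₁ n₂ : ℕ}
  (eV : Fin (N₁ + N₂) × Fin 1 ≃ Fin n) (e₁ : Fin N₁ × Fin 1 ≃ Fin n₁) (e₂ : Fin N₂ × Fin 1 ≃ Fin n₂)
  (J₁ : Matrix (Fin N₁) (Fin N₁) (F : Type)) (J₂ : Matrix (Fin N₂) (Fin N₂) (F : Type))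
  {T₁ : Matrix (Fin N₁) (Fin N₁) ↥(maximalRealSubfield (F : Type))} {T₂ : Matrix (Fin N₂) (Fin N₂) ↥(maximalRealSubfield (F : Type))}
  {δ : (F : Type)} (hcδ : (IsCMField.complexConj (F : Type)) δ = -δ) (hδ : δ ≠ 0) {d : ↥(maximalRealSubfield (F : Type))} (hd : δ * δ = algebraMap ↥(maximalRealSubfield (F : Type)) (F : Type) d)
  (h₁ : T₁.IsSymm) (h₂ : T₂.IsSymm) (h₁d : IsUnit T₁.det) (h₂d : IsUnit T₂.det) (hVd : IsUnit (finSum N₁ N₂ T₁ T₂).det)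
  (hJ₁ : J₁ = T₁.map (algebraMap ↥(maximalRealSubfield (F : Type)) (F : Type))) (hJ₂ : J₂ = T₂.map (algebraMap ↥(maximalRealSubfield (F : Type)) (F : Type)))
  (a : (↥(maximalRealSubfield (F : Type)))ˣ)
  {s : ↥(adelicPair ↥(maximalRealSubfield (F : Type)) (F : Type) (IsCMField.complexConj (F : Type)) (N₁ + N₂) 1 (finSum N₁ N₂ J₁ J₂) (Def411WeilCarriers.JW ↥(maximalRealSubfield (F : Type)) (F : Type) a)) →*
    adelicMpCont ↥(maximalRealSubfield (F : Type)) (Fin n) (adelicGram ↥(maximalRealSubfield (F : Type)) eV (finSum N₁ N₂ T₁ T₂) (Def411WeilCarriers.TW ↥(maximalRealSubfield (F : Type)) a))}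
  {s₁f : ∀ b : (↥(maximalRealSubfield (F : Type)))ˣ, ↥(adelicPair ↥(maximalRealSubfield (F : Type)) (F : Type) (IsCMField.complexConj (F : Type)) N₁ 1 J₁ (Def411WeilCarriers.JW ↥(maximalRealSubfield (F : Type)) (F : Type) b)) →*
    adelicMpCont ↥(maximalRealSubfield (F : Type)) (Fin n₁) (adelicGram ↥(maximalRealSubfield (F : Type)) e₁ T₁ (Def411WeilCarriers.TW ↥(maximalRealSubfield (F : Type)) b))}
  {s₂ : ↥(adelicPair ↥(maximalRealSubfield (F : Type)) (F : Type) (IsCMField.complexConj (F : Type)) N₂ 1 J₂ (Def411WeilCarriers.JW ↥(maximalRealSubfield (F : Type)) (F : Type) a)) →*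
    adelicMpCont ↥(maximalRealSubfield (F : Type)) (Fin n₂) (adelicGram ↥(maximalRealSubfield (F : Type)) e₂ T₂ (Def411WeilCarriers.TW ↥(maximalRealSubfield (F : Type)) a))}
  (hs : (splittingDatum ↥(maximalRealSubfield (F : Type)) (F : Type) (IsCMField.complexConj (F : Type)) (N₁ + N₂) 1 eV (finSum N₁ N₂ J₁ J₂) (Def411WeilCarriers.JW ↥(maximalRealSubfield (F : Type)) (F : Type) a) hcδ hδ hd
    (isSymm_finSum h₁ h₂) (Def411WeilCarriers.isSymm_TW ↥(maximalRealSubfield (F : Type)) a) hVd (Def411WeilCarriers.isUnit_det_TW ↥(maximalRealSubfield (F : Type)) a)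
    (finSum_eq_map_finSum ↥(maximalRealSubfield (F : Type)) (F : Type) N₁ N₂ J₁ J₂ hJ₁ hJ₂) (Def411WeilCarriers.JW_eq ↥(maximalRealSubfield (F : Type)) (F : Type) a)).IsCompatible s)
  (hs₁f : ∀ b : (↥(maximalRealSubfield (F : Type)))ˣ, (splittingDatum ↥(maximalRealSubfield (F : Type)) (F : Type) (IsCMField.complexConj (F : Type)) N₁ 1 e₁ J₁ (Def411WeilCarriers.JW ↥(maximalRealSubfield (F : Type)) (F : Type) b) hcδ hδ hd h₁
    (Def411WeilCarriers.isSymm_TW ↥(maximalRealSubfield (F : Type)) b) h₁d (Def411WeilCarriers.isUnit_det_TW ↥(maximalRealSubfield (F : Type)) b) hJ₁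
    (Def411WeilCarriers.JW_eq ↥(maximalRealSubfield (F : Type)) (F : Type) b)).IsCompatible (s₁f b))
  (hs₂ : (splittingDatum ↥(maximalRealSubfield (F : Type)) (F : Type) (IsCMField.complexConj (F : Type)) N₂ 1 e₂ J₂ (Def411WeilCarriers.JW ↥(maximalRealSubfield (F : Type)) (F : Type) a) hcδ hδ hd h₂
    (Def411WeilCarriers.isSymm_TW ↥(maximalRealSubfield (F : Type)) a) h₂d (Def411WeilCarriers.isUnit_det_TW ↥(maximalRealSubfield (F : Type)) a) hJ₂
    (Def411WeilCarriers.JW_eq ↥(maximalRealSubfield (F : Type)) (F : Type) a)).IsCompatible s₂)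
  (hχV : ∀ g₁ : ↥(adelic ↥(maximalRealSubfield (F : Type)) (F : Type) (IsCMField.complexConj (F : Type)) N₁ J₁), mpSeesawCharLeft ↥(maximalRealSubfield (F : Type)) (F : Type) (IsCMField.complexConj (F : Type)) N₁ N₂ 1 eV e₁ e₂ J₁ J₂ (Def411WeilCarriers.JW ↥(maximalRealSubfield (F : Type)) (F : Type) a) hcδ hδ hd h₁ h₂ (Def411WeilCarriers.isSymm_TW ↥(maximalRealSubfield (F : Type)) a) h₁d h₂d (Def411WeilCarriers.isUnit_det_TW ↥(maximalRealSubfield (F : Type)) a) hVd hJ₁ hJ₂ (Def411WeilCarriers.JW_eq ↥(maximalRealSubfield (F : Type)) (F : Type) a) hs (hs₁f a) hs₂ ((g₁, 1), 1) = 1)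
  (χface : Def411WeilCarriers.Chi ↥(maximalRealSubfield (F : Type)) (F : Type) (IsCMField.complexConj (F : Type)))
  (θ : ↥(finAdelic (↥(maximalRealSubfield F)) F (IsCMField.complexConj F) 2 Jstar) →* ↥(finAdelic ↥(maximalRealSubfield (F : Type)) (F : Type) (IsCMField.complexConj (F : Type)) N₁ J₁))

/-- **`hΦ` DISCHARGED**: `plugPhi` (face split at the adapted frame, then transport of the acting torus along `lineCenterEquiv a`)
intertwines the FACE representation `plugRho θ g = ω_χ(θ g ⊕ᶠ 1)` with `(plugRhoV θ ⊗ 1)(g) = (ω_f^{V₁}(s₁)(θ g) ⊗ 1)` on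
`Coinv (plugRho₁ ⊗ plugRho₂) plugChi` — ONE application of `splitCoinvEquiv_trans_coinvTransportEquiv_symm_rep_comp` at
`hV := finPairRepV_finAdelicBlockDiag_finSumTensorLeft`. [cite: Liu2021, proof of Thm. 4.15 (FJcycle.tex l. 2199–2210); App. D §D.1 Step 3 (l. 5221)] -/
theorem plugPhi_plugRho :
    ∀ (g : ↥(finAdelic (↥(maximalRealSubfield F)) F (IsCMField.complexConj F) 2 Jstar)) (w : Coinv (finPairRepW ↥(maximalRealSubfield (F : Type)) (F : Type) (IsCMField.complexConj (F : Type)) (N₁ + N₂) 1 eV (finSum N₁ N₂ J₁ J₂) (Def411WeilCarriers.JW ↥(maximalRealSubfield (F : Type)) (F : Type) a) hcδ hδ hd (isSymm_finSum h₁ h₂) (Def411WeilCarriers.isSymm_TW ↥(maximalRealSubfield (F : Type)) a) hVd (Def411WeilCarriers.isUnit_det_TW ↥(maximalRealSubfield (F : Type)) a) (finSum_eq_map_finSum ↥(maximalRealSubfield (F : Type)) (F : Type) N₁ N₂ J₁ J₂ hJ₁ hJ₂) (Def411WeilCarriers.JW_eq ↥(maximalRealSubfield (F : Type)) (F : Type)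 a) hs) (Def411WeilCarriers.lineChar ↥(maximalRealSubfield (F : Type)) (F : Type) (IsCMField.complexConj (F : Type)) a χface.1)),
      plugPhi N₁ N₂ eV e₁ e₂ J₁ J₂ hcδ hδ hd h₁ h₂ h₁d h₂d hVd hJ₁ hJ₂ a hs hs₁f hs₂ hχV χface (plugRho N₁ N₂ eV J₁ J₂ hcδ hδ hd h₁ h₂ hVd hJ₁ hJ₂ a hs χface θ g w) =
        rep (plugChi N₁ N₂ eV e₁ e₂ J₁ J₂ hcδ hδ hd h₁ h₂ h₁d h₂d hVd hJ₁ hJ₂ a hs hs₁f hs₂ χface) _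
          (commute_tprod_one (plugRho₁ N₁ e₁ J₁ hcδ hδ hd h₁ h₁d hJ₁ a hs₁f) (plugRho₂ N₂ e₂ J₂ hcδ hδ hd h₂ h₂d hJ₂ a hs₂) (plugRhoV N₁ e₁ J₁ hcδ hδ hd h₁ h₁d hJ₁ a hs₁f θ) (plug_hc N₁ e₁ J₁ hcδ hδ hd h₁ h₁d hJ₁ a hs₁f θ)) g
          (plugPhi N₁ N₂ eV e₁ e₂ J₁ J₂ hcδ hδ hd h₁ h₂ h₁d h₂d hVd hJ₁ hJ₂ a hs hs₁f hs₂ hχV χface w) := fun g w =>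
  splitCoinvEquiv_trans_coinvTransportEquiv_symm_rep_comp
    (finPairRepW ↥(maximalRealSubfield (F : Type)) (F : Type) (IsCMField.complexConj (F : Type)) (N₁ + N₂) 1 eV (finSum N₁ N₂ J₁ J₂) (Def411WeilCarriers.JW ↥(maximalRealSubfield (F : Type)) (F : Type) a) hcδ hδ hd (isSymm_finSum h₁ h₂) (Def411WeilCarriers.isSymm_TW ↥(maximalRealSubfield (F : Type)) a) hVd (Def411WeilCarriers.isUnit_det_TW ↥(maximalRealSubfield (F : Type)) a) (finSum_eq_map_finSum ↥(maximalRealSubfield (F : Type)) (F : Type) N₁ N₂ J₁ J₂ hJ₁ hJ₂) (Def411WeilCarriers.JW_eq ↥(maximalRealSubfield (F : Type)) (F : Type) a) hs)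
    (finPairRepW ↥(maximalRealSubfield (F : Type)) (F : Type) (IsCMField.complexConj (F : Type)) N₁ 1 e₁ J₁ (Def411WeilCarriers.JW ↥(maximalRealSubfield (F : Type)) (F : Type) a) hcδ hδ hd h₁ (Def411WeilCarriers.isSymm_TW ↥(maximalRealSubfield (F : Type)) a) h₁d (Def411WeilCarriers.isUnit_det_TW ↥(maximalRealSubfield (F : Type)) a) hJ₁ (Def411WeilCarriers.JW_eq ↥(maximalRealSubfield (F : Type)) (F : Type) a) (hs₁f a))
    (finPairRepW ↥(maximalRealSubfield (F : Type)) (F : Type) (IsCMField.complexConj (F : Type)) N₂ 1 e₂ J₂ (Def411WeilCarriers.JW ↥(maximalRealSubfield (F : Type)) (F : Type) a) hcδ hδ hd h₂ (Def411WeilCarriers.isSymm_TW ↥(maximalRealSubfield (F : Type)) a) h₂d (Def411WeilCarriers.isUnit_det_TW ↥(maximalRealSubfield (F : Type)) a) hJ₂ (Def411WeilCarriers.JW_eq ↥(maximalRealSubfield (F : Type)) (F : Type) a) hs₂)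
    (finPairRepV ↥(maximalRealSubfield (F : Type)) (F : Type) (IsCMField.complexConj (F : Type)) (N₁ + N₂) 1 eV (finSum N₁ N₂ J₁ J₂) (Def411WeilCarriers.JW ↥(maximalRealSubfield (F : Type)) (F : Type) a) hcδ hδ hd (isSymm_finSum h₁ h₂) (Def411WeilCarriers.isSymm_TW ↥(maximalRealSubfield (F : Type)) a) hVd (Def411WeilCarriers.isUnit_det_TW ↥(maximalRealSubfield (F : Type)) a) (finSum_eq_map_finSum ↥(maximalRealSubfield (F : Type)) (F : Type) N₁ N₂ J₁ J₂ hJ₁ hJ₂) (Def411WeilCarriers.JW_eq ↥(maximalRealSubfield (F : Type)) (F : Type) a) hs)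
    (finPairRepV ↥(maximalRealSubfield (F : Type)) (F : Type) (IsCMField.complexConj (F : Type)) N₁ 1 e₁ J₁ (Def411WeilCarriers.JW ↥(maximalRealSubfield (F : Type)) (F : Type) a) hcδ hδ hd h₁ (Def411WeilCarriers.isSymm_TW ↥(maximalRealSubfield (F : Type)) a) h₁d (Def411WeilCarriers.isUnit_det_TW ↥(maximalRealSubfield (F : Type)) a) hJ₁ (Def411WeilCarriers.JW_eq ↥(maximalRealSubfield (F : Type)) (F : Type) a) (hs₁f a))
    (finSumTensorLeft ↥(maximalRealSubfield (F : Type)) N₁ N₂ 1)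
    (seesawCharW ↥(maximalRealSubfield (F : Type)) (F : Type) (IsCMField.complexConj (F : Type)) N₁ N₂ 1 eV e₁ e₂ J₁ J₂ (Def411WeilCarriers.JW ↥(maximalRealSubfield (F : Type)) (F : Type) a) hcδ hδ hd h₁ h₂ (Def411WeilCarriers.isSymm_TW ↥(maximalRealSubfield (F : Type)) a) h₁d h₂d (Def411WeilCarriers.isUnit_det_TW ↥(maximalRealSubfield (F : Type)) a) hVd hJ₁ hJ₂ (Def411WeilCarriers.JW_eq ↥(maximalRealSubfield (F : Type)) (F : Type) a) hs (hs₁f a) hs₂)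
    (Def411WeilCarriers.lineChar ↥(maximalRealSubfield (F : Type)) (F : Type) (IsCMField.complexConj (F : Type)) a χface.1)
    (finPairRepW_finSumTensorLeft ↥(maximalRealSubfield (F : Type)) (F : Type) (IsCMField.complexConj (F : Type)) N₁ N₂ 1 eV e₁ e₂ J₁ J₂ (Def411WeilCarriers.JW ↥(maximalRealSubfield (F : Type)) (F : Type) a) hcδ hδ hd h₁ h₂ (Def411WeilCarriers.isSymm_TW ↥(maximalRealSubfield (F : Type)) a) h₁d h₂d (Def411WeilCarriers.isUnit_det_TW ↥(maximalRealSubfield (F : Type)) a) hVd hJ₁ hJ₂ (Def411WeilCarriers.JW_eq ↥(maximalRealSubfield (F : Type)) (F : Type) a) hs (hs₁f a) hs₂ hχV)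
    (commute_finPairRepV_finPairRepW ↥(maximalRealSubfield (F : Type)) (F : Type) (IsCMField.complexConj (F : Type)) (N₁ + N₂) 1 eV (finSum N₁ N₂ J₁ J₂) (Def411WeilCarriers.JW ↥(maximalRealSubfield (F : Type)) (F : Type) a) hcδ hδ hd (isSymm_finSum h₁ h₂) (Def411WeilCarriers.isSymm_TW ↥(maximalRealSubfield (F : Type)) a) hVd (Def411WeilCarriers.isUnit_det_TW ↥(maximalRealSubfield (F : Type)) a) (finSum_eq_map_finSum ↥(maximalRealSubfield (F : Type)) (F : Type) N₁ N₂ J₁ J₂ hJ₁ hJ₂) (Def411WeilCarriers.JW_eq ↥(maximalRealSubfield (F : Type)) (F : Type) a) hs)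
    ((finAdelicBlockDiag ↥(maximalRealSubfield (F : Type)) (F : Type) (IsCMField.complexConj (F : Type)) N₁ N₂ J₁ J₂).comp
      ((MonoidHom.inl ↥(finAdelic ↥(maximalRealSubfield (F : Type)) (F : Type) (IsCMField.complexConj (F : Type)) N₁ J₁) ↥(finAdelic ↥(maximalRealSubfield (F : Type)) (F : Type) (IsCMField.complexConj (F : Type)) N₂ J₂)).comp θ)) θ
    (fun g x => by
      rw [MonoidHom.comp_apply, MonoidHom.comp_apply, MonoidHom.inl_apply]
      exact finPairRepV_finAdelicBlockDiag_finSumTensorLeft ↥(maximalRealSubfield (F : Type)) (F : Type) (IsCMField.complexConj (F : Type)) N₁ N₂ 1 eV e₁ e₂ J₁ J₂ (Def411WeilCarriers.JW ↥(maximalRealSubfield (F : Type)) (F : Type) a) hcδ hδ hd h₁ h₂ (Def411WeilCarriers.isSymm_TW ↥(maximalRealSubfield (F : Type)) a) h₁d h₂d (Def411WeilCarriers.isUnit_det_TW ↥(maximalRealSubfield (F : Type)) a) hVd hJ₁ hJ₂ (Def411WeilCarriers.JW_eq ↥(maximalRealSubfield (F : Type)) (F : Type) a) hs (hs₁f a)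 hs₂ hχV (θ g) x)
    (Def411WeilCarriers.lineCenterEquiv ↥(maximalRealSubfield (F : Type)) (F : Type) (IsCMField.complexConj (F : Type)) a)
    (plugChi N₁ N₂ eV e₁ e₂ J₁ J₂ hcδ hδ hd h₁ h₂ h₁d h₂d hVd hJ₁ hJ₂ a hs hs₁f hs₂ χface) (fun _ => rfl)
    (commute_tprod_one (plugRho₁ N₁ e₁ J₁ hcδ hδ hd h₁ h₁d hJ₁ a hs₁f) (plugRho₂ N₂ e₂ J₂ hcδ hδ hd h₂ h₂d hJ₂ a hs₂)
      (plugRhoV N₁ e₁ J₁ hcδ hδ hd h₁ h₁d hJ₁ a hs₁f θ) (plug_hc N₁ e₁ J₁ hcδ hδ hd h₁ h₁d hJ₁ a hs₁f θ)) g w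

/-- **G2c PLUGGED with NO junction left** (= `exists_factor_slice_mem_omegaHom_plug` fed with `plugPhi_plugRho`): for every
occurring `ψ` and every `f′ ∈ Hom_{U(J⋆)(𝔸_f)}(ι′ ∘ (ω_χ ∘ (·⊕ᶠ1) ∘ θ), ℚ_ℓ^{ac} ⊗ H¹_ét)`, the per-label factorisation
`p_ψ ∘ f′ = g ∘ q` with slices in `Hom(ι′ ∘ (rhoVAtLine[J₁] … a ψ̃ ∘ θ), ℚ_ℓ^{ac} ⊗ H¹_ét)`. Remaining inputs: `θ`/`hθ`, the
splittings, `hχV` (= `stub_R`), `hf′`. [cite: Liu2021, proof of Thm. 4.15 (FJcycle.tex l. 2199–2212); App. D §D.1 Step 3 (l. 5221)] -/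
theorem exists_factor_slice_mem_omegaHom_plug'
    (hθ : ∀ z : ↥(finAdelicOne ↥(maximalRealSubfield (F : Type)) (F : Type) (IsCMField.complexConj (F : Type))), θ (finAdelicCenter ↥(maximalRealSubfield (F : Type)) (F : Type) (IsCMField.complexConj (F : Type)) 2 Jstar z) = finAdelicCenter ↥(maximalRealSubfield (F : Type)) (F : Type) (IsCMField.complexConj (F : Type)) N₁ J₁ z)
    (ψ : ↥(finAdelicOne ↥(maximalRealSubfield (F : Type)) (F : Type) (IsCMField.complexConj (F : Type))) →* (AlgebraicClosure ℚ_[ℓ])ˣ) {v : AlgebraicClosure ℚ_[ℓ] ⊗[ℚ_[ℓ]] (sec42DataGS S h4 isoₛ).etaleH1Tower ℓ}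
    (hv : weightProj (rhoEtCenterGSExt S hU7ₛ hLQ h4 isoₛ ℓ (AlgebraicClosure ℚ_[ℓ])) (exists_finiteIndex_forall_rhoEtCenterGSExt_eq S hU7ₛ hLQ h4 isoₛ ℓ (AlgebraicClosure ℚ_[ℓ])) ψ v ≠ 0)
    {f' : Coinv (finPairRepW ↥(maximalRealSubfield (F : Type)) (F : Type) (IsCMField.complexConj (F : Type)) (N₁ + N₂) 1 eV (finSum N₁ N₂ J₁ J₂) (Def411WeilCarriers.JW ↥(maximalRealSubfield (F : Type)) (F : Type) a) hcδ hδ hd (isSymm_finSum h₁ h₂) (Def411WeilCarriers.isSymm_TW ↥(maximalRealSubfield (F : Type)) a) hVd (Def411WeilCarriers.isUnit_det_TW ↥(maximalRealSubfield (F : Type)) a) (finSum_eq_map_finSum ↥(maximalRealSubfield (F : Type)) (F : Type) N₁ N₂ J₁ J₂ hJ₁ hJ₂) (Def411WeilCarriers.JW_eq ↥(maximalRealSubfield (F : Type)) (F : Type) a) hs) (Def411WeilCarriers.lineChar ↥(maximalRealSubfield (F : Type)) (F : Type) (IsCMField.complexConj (F : Type)) a χface.1) →ₛₗ[(ι' :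 ℂ →+* AlgebraicClosure ℚ_[ℓ])] AlgebraicClosure ℚ_[ℓ] ⊗[ℚ_[ℓ]] (sec42DataGS S h4 isoₛ).etaleH1Tower ℓ}
    (hf' : f' ∈ (etaleHeckeDatumGS S hU7ₛ hLQ h4 isoₛ ℓ).omegaHom ι' (plugRho N₁ N₂ eV J₁ J₂ hcδ hδ hd h₁ h₂ hVd hJ₁ hJ₂ a hs χface θ)) :
    ∃ g : Def411WeilCarriers.omegaAtLine ↥(maximalRealSubfield (F : Type)) (F : Type) (IsCMField.complexConj (F : Type)) N₁ e₁ J₁ hcδ hδ hd h₁ h₁d hJ₁ hs₁f a (chiOfWeight S hU7ₛ hLQ h4 isoₛ ℓ ι' ψ hv) ⊗[ℂ]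
          Coinv (plugRho₂ N₂ e₂ J₂ hcδ hδ hd h₂ h₂d hJ₂ a hs₂) (plugChi N₁ N₂ eV e₁ e₂ J₁ J₂ hcδ hδ hd h₁ h₂ h₁d h₂d hVd hJ₁ hJ₂ a hs hs₁f hs₂ χface * (psiTilde ℓ ι' ψ)⁻¹) →ₛₗ[(ι' : ℂ →+* AlgebraicClosure ℚ_[ℓ])]
        AlgebraicClosure ℚ_[ℓ] ⊗[ℚ_[ℓ]] (sec42DataGS S h4 isoₛ).etaleH1Tower ℓ,
      (∀ w, weightProj (rhoEtCenterGSExt S hU7ₛ hLQ h4 isoₛ ℓ (AlgebraicClosure ℚ_[ℓ])) (exists_finiteIndex_forall_rhoEtCenterGSExt_eq S hU7ₛ hLQ h4 isoₛ ℓ (AlgebraicClosure ℚ_[ℓ])) ψ (f' w) =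
        g (TensorProduct.congr (plugE S hU7ₛ hLQ h4 isoₛ ℓ ι' N₁ e₁ J₁ hcδ hδ hd h₁ h₁d hJ₁ a hs₁f ψ hv) (LinearEquiv.refl ℂ (Coinv (plugRho₂ N₂ e₂ J₂ hcδ hδ hd h₂ h₂d hJ₂ a hs₂) (plugChi N₁ N₂ eV e₁ e₂ J₁ J₂ hcδ hδ hd h₁ h₂ h₁d h₂d hVd hJ₁ hJ₂ a hs hs₁f hs₂ χface * (psiTilde ℓ ι' ψ)⁻¹)))
          (coinvTprodQuot (plugRho₁ N₁ e₁ J₁ hcδ hδ hd h₁ h₁d hJ₁ a hs₁f) (plugRho₂ N₂ e₂ J₂ hcδ hδ hd h₂ h₂d hJ₂ a hs₂) (plugChi N₁ N₂ eV e₁ e₂ J₁ J₂ hcδ hδ hd h₁ h₂ h₁d h₂d hVd hJ₁ hJ₂ a hs hs₁f hs₂ χface) (psiTilde ℓ ι' ψ) (plugPhi N₁ N₂ eV e₁ e₂ J₁ J₂ hcδ hδ hd h₁ h₂ h₁d h₂d hVd hJ₁ hJ₂ a hs hs₁f hs₂ hχV χface w)))) ∧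
      ∀ m : Coinv (plugRho₂ N₂ e₂ J₂ hcδ hδ hd h₂ h₂d hJ₂ a hs₂) (plugChi N₁ N₂ eV e₁ e₂ J₁ J₂ hcδ hδ hd h₁ h₂ h₁d h₂d hVd hJ₁ hJ₂ a hs hs₁f hs₂ χface * (psiTilde ℓ ι' ψ)⁻¹),
        g.comp ((TensorProduct.mk ℂ (Def411WeilCarriers.omegaAtLine ↥(maximalRealSubfield (F : Type)) (F : Type) (IsCMField.complexConj (F : Type)) N₁ e₁ J₁ hcδ hδ hd h₁ h₁d hJ₁ hs₁f a (chiOfWeight S hU7ₛ hLQ h4 isoₛ ℓ ι' ψ hv))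
          (Coinv (plugRho₂ N₂ e₂ J₂ hcδ hδ hd h₂ h₂d hJ₂ a hs₂) (plugChi N₁ N₂ eV e₁ e₂ J₁ J₂ hcδ hδ hd h₁ h₂ h₁d h₂d hVd hJ₁ hJ₂ a hs hs₁f hs₂ χface * (psiTilde ℓ ι' ψ)⁻¹))).flip m) ∈
          (etaleHeckeDatumGS S hU7ₛ hLQ h4 isoₛ ℓ).omegaHom ι' (plugRho' S hU7ₛ hLQ h4 isoₛ ℓ ι' N₁ e₁ J₁ hcδ hδ hd h₁ h₁d hJ₁ a hs₁f θ ψ hv) :=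
  exists_factor_slice_mem_omegaHom_plug S hU7ₛ hLQ h4 isoₛ ℓ ι' N₁ N₂ eV e₁ e₂ J₁ J₂ hcδ hδ hd h₁ h₂ h₁d h₂d hVd hJ₁ hJ₂ a hs hs₁f
    hs₂ hχV χface θ hθ (plugPhi_plugRho N₁ N₂ eV e₁ e₂ J₁ J₂ hcδ hδ hd h₁ h₂ h₁d h₂d hVd hJ₁ hJ₂ a hs hs₁f hs₂ hχV χface θ) ψ hv hf'

end G2cPlugHPhi

end Summit.HodgeConjecture.CorCM.Lines.A3Liu418

end
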